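import Literature.Analysis.FluidPDE.BiotSavartHolder
import Literature.Analysis.FunctionSpaces.ContDiffHolderOne
import Literature.Analysis.FunctionSpaces.HolderAlgebra
import Literature.Analysis.FunctionSpaces.C1HolderMap
import HarnessLib

/-!
# `K₃ ω ∈ C^{1,γ}` with bounds: Majda–Bertozzi (4.38)–(4.39) for the Biot–Savart law

Topic `Literature/Analysis/FluidPDE`. Packaging of the potential-theory estimates of
`BiotSavartBounds.lean` (`|K₃ ω|₀ ≤ 5 |ω|₀ R`, Majda–Bertozzi Lemma 4.5 / (4.38)),
`BiotSavartGradient.lean` (`K₃ ω ∈ C¹`) and `BiotSavartHolder.lean` (sup and Hölder bounds for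
`∇(K₃ ω)`, Lemma 4.6 (4.36) / (4.39)) in the tree's velocity class
`FunctionSpaces.MemContDiffHolder 1 γ` (= `FluidPDE.MemC1Holder γ`, the slice class of
`IsHolderEulerSolution`) and its norm `eContDiffHolderNorm 1 γ`
(Majda–Bertozzi, *Vorticity and Incompressible Flow* (CUP 2002), §4.1.3, p. 129 of the held
text: (4.38) `|K₃f(0)| ≤ |K₃ f|₀ ≤ c|f|₀`, (4.39) `|K₃ f|_{1,γ} ≤ c ‖f‖_γ`, for compactly
supported `f ∈ C^γ`, `0 < γ < 1`, the constant depending on the support radius `R`).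

## Contents (all proved)

* `exists_biotSavart_c1Holder_bounds` — for `0 < γ < 1` there is `c = c(γ) ≥ 0` with: for every
  `γ`-Hölder `ω` (constant `C`) supported in `B̄(x₀, R)` and bounded by `M`, `K₃ ω ∈ C^{1,γ}_b`,
  `|K₃ ω| ≤ 5MR`, `|∇K₃ ω| ≤ c(C R^γ + M)`, `∇K₃ ω` is `γ`-Hölder with constant
  `c(C + M R^{−γ})`, and `‖K₃ ω‖_{C^{1,γ}} ≤ 5MR + c(CR^γ + M) + c(C + MR^{−γ})`;
* `C1HolderMap.norm_le_of_bounds` — the `B`-norm `|X(0)| + |∇X|₀ + [∇X]_γ` of an element of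
  `C1HolderMap` from real bounds (for the Lagrangian operator `F(X) = K₃(…)`, MB Prop. 4.2);
* `exists_biotSavart_c1HolderMap_norm_le` — `‖K₃ ω‖_B ≤ 5MR + c(CR^γ + M) + c(C + MR^{−γ})`;
* `memContDiffHolder_one_biotSavart` — the qualitative statement `K₃ ω ∈ C^{1,γ}_b`
  (`= FluidPDE.MemC1Holder γ (biotSavart ω)` by `rfl`, `AxisymmetricEuler.lean`).

## References

* A. J. Majda, A. L. Bertozzi, *Vorticity and Incompressible Flow* (CUP 2002), §4.1.3
  Lemmas 4.5–4.6, (4.38)–(4.39). [MajdaBertozziCUP2002]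
-/

noncomputable section

open MeasureTheory Set Function Filter Metric Real
open _root_.Topology
open scoped ENNReal NNReal

/-! ### The `B`-norm from real bounds -/

namespace Literature.Analysis.FunctionSpaces.C1HolderMap

variable {E F : Type*} [NormedAddCommGroup E] [NormedSpace ℝ E] [NormedAddCommGroup F]
  [NormedSpace ℝ F] {r : ℝ≥0}

/-- **The `B`-norm from real bounds**: if `‖f 0‖ ≤ a`, `‖Df‖ ≤ M₁` pointwise (`M₁ ≥ 0`) and `Df`
is `r`-Hölder with constant `C`, then `‖f‖_B = ‖f 0‖ + ‖Df‖_∞ + [Df]_r ≤ a + M₁ + C`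
(Majda–Bertozzi (4.12)–(4.13)). Declared in the namespace of the structure (another directory)
for dot notation. [folklore] -/
theorem norm_le_of_bounds (f : C1HolderMap E F r) {a M₁ : ℝ} {C : ℝ≥0} (h0 : ‖f 0‖ ≤ a)
    (hM₁ : 0 ≤ M₁) (h1 : ∀ x, ‖fderiv ℝ (f : E → F) x‖ ≤ M₁)
    (hC : HolderWith C r (fderiv ℝ (f : E → F))) : ‖f‖ ≤ a + M₁ + C := by
  rw [norm_def, BoundedHolderFunction.norm_def]
  have h2 : ‖f.fderivBHF.toBoundedContinuousFunction‖ ≤ M₁ :=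
    (BoundedContinuousFunction.norm_le hM₁).2 fun x => h1 x
  have h3 : (nnHolderNorm r (f.fderivBHF : E → E →L[ℝ] F) : ℝ) ≤ C := by
    rw [coe_fderivBHF]
    exact_mod_cast hC.nnholderNorm_le
  linarith

end Literature.Analysis.FunctionSpaces.C1HolderMap

namespace Literature.Analysis.FluidPDE

/-- Local notation for physical space `ℝ³ = EuclideanSpace ℝ (Fin 3)`. -/
local notation "ℝ³" => EuclideanSpace ℝ (Fin 3)

/-- **`K₃ ω ∈ C^{1,γ}` with bounds (Majda–Bertozzi (4.38)–(4.39))**: for `0 < γ < 1` there is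
`c = c(γ) ≥ 0` such that for every `γ`-Hölder vorticity `ω` with constant `C`, supported in
`B̄(x₀, R)`, `R > 0`, and bounded by `M`: `K₃ ω ∈ C^{1,γ}_b`; `|K₃ ω(x)| ≤ 5MR`;
`|∇K₃ ω(x)| ≤ c (C R^γ + M)`; `∇K₃ ω` is `γ`-Hölder with constant `c (C + M R^{−γ})`; and
`‖K₃ ω‖_{C^{1,γ}} ≤ 5MR + c (C R^γ + M) + c (C + M R^{−γ})`. [cite: MajdaBertozziCUP2002, §4.1.3 (4.38)–(4.39) with Lemmas 4.5–4.6] -/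
theorem exists_biotSavart_c1Holder_bounds {γ : ℝ≥0} (hγ : 0 < γ) (hγ1 : (γ : ℝ) < 1) :
    ∃ c : ℝ, 0 ≤ c ∧ ∀ (ω : ℝ³ → ℝ³) (C : ℝ≥0) (x₀ : ℝ³) (R M : ℝ), 0 < R → HolderWith C γ ω →
      tsupport ω ⊆ closedBall x₀ R → (∀ y, ‖ω y‖ ≤ M) →
        FunctionSpaces.MemContDiffHolder 1 γ (biotSavart ω) ∧
        (∀ x, ‖biotSavart ω x‖ ≤ 5 * M * R) ∧
        (∀ x, ‖fderiv ℝ (biotSavart ω) x‖ ≤ c * (C * R ^ (γ : ℝ) + M)) ∧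
        HolderWith (Real.toNNReal (c * (C + M * (R ^ (γ : ℝ))⁻¹))) γ (fderiv ℝ (biotSavart ω)) ∧
        FunctionSpaces.eContDiffHolderNorm 1 γ (biotSavart ω) ≤
          ENNReal.ofReal (5 * M * R) + ENNReal.ofReal (c * (C * R ^ (γ : ℝ) + M)) +
            ENNReal.ofReal (c * (C + M * (R ^ (γ : ℝ))⁻¹)) := by
  obtain ⟨c₁, hc₁0, hc₁⟩ := exists_norm_fderiv_biotSavart_le hγ
  obtain ⟨c₂, hc₂0, hc₂⟩ := exists_norm_fderiv_biotSavart_sub_le hγ hγ1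
  refine ⟨max c₁ c₂, le_max_of_le_left hc₁0, fun ω C x₀ R M hR hω hsupp hM => ?_⟩
  have hM0 : 0 ≤ M := (norm_nonneg _).trans (hM x₀)
  have hsupp' : support ω ⊆ closedBall x₀ R := (subset_tsupport ω).trans hsupp
  have hωc : HasCompactSupport ω :=
    (isCompact_closedBall x₀ R).of_isClosed_subset (isClosed_tsupport ω) hsupp
  have h0 : ∀ x, ‖biotSavart ω x‖ ≤ 5 * M * R := norm_biotSavart_le_of_support_subset hR hM hsupp'
  have hRγ : 0 ≤ R ^ (γ : ℝ) := by positivity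
  have h1 : ∀ x, ‖fderiv ℝ (biotSavart ω) x‖ ≤ max c₁ c₂ * (C * R ^ (γ : ℝ) + M) := fun x =>
    (hc₁ ω C x₀ R M hR hω hsupp hM x).trans
      (mul_le_mul_of_nonneg_right (le_max_left _ _) (by positivity))
  have hL0 : 0 ≤ max c₁ c₂ * (C + M * (R ^ (γ : ℝ))⁻¹) :=
    mul_nonneg (le_max_of_le_left hc₁0) (by positivity)
  have h2 : HolderWith (Real.toNNReal (max c₁ c₂ * (C + M * (R ^ (γ : ℝ))⁻¹))) γ
      (fderiv ℝ (biotSavart ω)) := by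
    refine FunctionSpaces.holderWith_of_dist_le fun x y => ?_
    rw [dist_eq_norm, dist_eq_norm, Real.coe_toNNReal _ hL0]
    refine (hc₂ ω C x₀ R M hR hω hsupp hM x y).trans ?_
    exact mul_le_mul_of_nonneg_right
      (mul_le_mul_of_nonneg_right (le_max_right _ _) (by positivity)) (by positivity)
  have hcd : ContDiff ℝ 1 (biotSavart ω) := contDiff_biotSavart hγ hω hωc
  exact ⟨FunctionSpaces.memContDiffHolder_one_of_bounds hcd h0 h1 h2, h0, h1, h2,
    FunctionSpaces.eContDiffHolderNorm_one_le_of_bounds h0 h1 h2⟩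

/-- **`K₃ ω` in the Banach space `B`** (Majda–Bertozzi (4.39) in the norm (4.13)
`|X|_{1,γ} = |X(0)| + |∇X|₀ + |∇X|_γ` of `C1HolderMap`): with the constant `c(γ)` of
`exists_biotSavart_c1Holder_bounds`, the element of `B` defined by `K₃ ω` has norm
`≤ 5MR + c (C R^γ + M) + c (C + M R^{−γ})`. [cite: MajdaBertozziCUP2002, §4.1.3 (4.38)–(4.39) with (4.13)] -/
theorem exists_biotSavart_c1HolderMap_norm_le {γ : ℝ≥0} (hγ : 0 < γ) (hγ1 : (γ : ℝ) < 1) :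
    ∃ c : ℝ, 0 ≤ c ∧ ∀ (ω : ℝ³ → ℝ³) (C : ℝ≥0) (x₀ : ℝ³) (R M : ℝ) (hR : 0 < R)
      (hω : HolderWith C γ ω) (hsupp : tsupport ω ⊆ closedBall x₀ R) (hM : ∀ y, ‖ω y‖ ≤ M),
        ∃ hmem : FunctionSpaces.MemContDiffHolder 1 γ (biotSavart ω),
          ‖hmem.toC1HolderMap‖ ≤
            5 * M * R + c * (C * R ^ (γ : ℝ) + M) + c * (C + M * (R ^ (γ : ℝ))⁻¹) := by
  obtain ⟨c, hc0, hc⟩ := exists_biotSavart_c1Holder_bounds hγ hγ1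
  refine ⟨c, hc0, fun ω C x₀ R M hR hω hsupp hM => ?_⟩
  obtain ⟨hmem, h0, h1, h2, -⟩ := hc ω C x₀ R M hR hω hsupp hM
  have hM0 : 0 ≤ M := (norm_nonneg _).trans (hM x₀)
  have hRγ : 0 ≤ R ^ (γ : ℝ) := by positivity
  have hL0 : 0 ≤ c * (C + M * (R ^ (γ : ℝ))⁻¹) := by positivity
  refine ⟨hmem, ?_⟩
  have h := hmem.toC1HolderMap.norm_le_of_bounds (a := 5 * M * R) (M₁ := c * (C * R ^ (γ : ℝ) + M))
    (C := Real.toNNReal (c * (C + M * (R ^ (γ : ℝ))⁻¹))) (h0 0) (by positivity) h1 h2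
  rwa [Real.coe_toNNReal _ hL0] at h

/-- **The Biot–Savart velocity of a compactly supported `γ`-Hölder vorticity, `0 < γ < 1`, is of
class `C^{1,γ}_b`** (Majda–Bertozzi (4.39), qualitative form; the slice regularity
`MemC1Holder γ` of the Euler class `IsHolderEulerSolution`). [cite: MajdaBertozziCUP2002, §4.1.3 (4.39)] -/
theorem memContDiffHolder_one_biotSavart {γ C : ℝ≥0} (hγ : 0 < γ) (hγ1 : (γ : ℝ) < 1)
    {ω : ℝ³ → ℝ³} (hω : HolderWith C γ ω) (hωc : HasCompactSupport ω) :
    FunctionSpaces.MemContDiffHolder 1 γ (biotSavart ω) := by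
  obtain ⟨c, -, hc⟩ := exists_biotSavart_c1Holder_bounds hγ hγ1
  -- enclose the support in a ball of positive radius and bound `ω`
  obtain ⟨R₀, hR₀⟩ := hωc.isCompact.isBounded.subset_closedBall (0 : ℝ³)
  obtain ⟨M, hM⟩ := (hω.continuous hγ).bounded_above_of_compact_support hωc
  have hsupp : tsupport ω ⊆ closedBall (0 : ℝ³) (max R₀ 1) :=
    hR₀.trans (closedBall_subset_closedBall (le_max_left _ _))
  exact (hc ω C 0 (max R₀ 1) M (lt_max_of_lt_right one_pos) hω hsupp hM).1

end Literature.Analysis.FluidPDE
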